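import Summits.AtomisticToContinuum.Crystallization.Theorems.OverbindingBudgetAffineTwinGainKernel
import Literature.MathematicalPhysics.StatisticalMechanics.HcpFccLatticeSumsRegistry
import Literature.MathematicalPhysics.StatisticalMechanics.HcpFccLatticeSumsKernelA4
import Literature.MathematicalPhysics.StatisticalMechanics.HcpFccLatticeSumsKernelA5

/-!
# `OverbindingBudget` / crux `RobustDefectLimitWindows` (stmt-AtomisticToContinuum-31280) — «TwinGain» part E: registry-coupling bounds

Support file (lens-4 g84, instrument literal **TGI** `IdealTwinGain` of `…OverbindingBudgetAffineTwinCut` §6).  The numerical inputs of the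
twin-gain certificate that the Literature kit does not already hold:

* `registryCoupling_three_abs_at_k` (`k ∈ {5,6,7,11,12,13,17,18,19}`) — certified absolute enclosures `|J⁽³⁾(2k²/3)| ≤ β₃(k)` from the
  kernel floor sums of part K and of `…HcpFccLatticeSumsKernelA4/A5` (the hcp-parity partners) through `boxFloorSum_sound_le/_ge` (`…HcpFccLatticeSumsEval`) and the in-plane tail `registryCoupling_three_tail`
  (`R = 40`), verbatim the pattern of `…HcpFccLatticeSumsNumJ3a` (which holds `k ∈ {2,3,4,8,9,10,14,15,16,20,21}`); the literals `β₃` are the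
  exact certified bounds rounded OUTWARD to two significant digits (slack ≥ 4 %);
* `registryCoupling_six_abs_crude` — `|J⁽⁶⁾(s)| ≤ s⁻⁶ + (24/5) s⁻⁵` for every `s > 0` (both layer sums are nonnegative and bounded by
  `layerSum_le_of_pos`, `…HcpFccLatticeSumsTail`); used at the layers `5 ≤ k ≤ 21`;
* `registryCoupling_three_abs_far` / `registryCoupling_six_abs_far` — the layer majorants `|J⁽³⁾(2k²/3)| ≤ 125·k⁻⁶`, `|J⁽⁶⁾(2k²/3)| ≤ k⁻⁶/5000`
  for `k ≥ 22` (from `registryCoupling_three_abs`, `s ≥ 320`, resp. the crude bound), summed in part C against `sum_inv_pow_Ioc_le`.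
[this file: 13 theorems; no definitions; standard axioms]
-/

noncomputable section

namespace Summit.AtomisticToContinuum.Crystallization.Theorems.OverbindingBudgetAffineTwinGainEnclosures

open Finset
open Literature.MathematicalPhysics.StatisticalMechanics.StackingSums
open Summit.AtomisticToContinuum.Crystallization.Theorems.OverbindingBudgetAffineTwinGainKernel

/-- From a two-sided enclosure `lo ≤ x ≤ hi` with `−hi ≤ lo` to the absolute bound `|x| ≤ hi`. [this file · kind: proof] -/
theorem abs_le_of_enclosure {x lo hi : ℝ} (h : lo ≤ x ∧ x ≤ hi) (hlo : -hi ≤ lo) : |x| ≤ hi :=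
  abs_le.2 ⟨hlo.trans h.1, h.2⟩

/-! ## Nine certified enclosures of `J⁽³⁾(2k²/3)` (box `40`, both patterns, in-plane tail) -/

/-- **`|J⁽3⁾(2·5²/3)| ≤ 0.000000022`**, certified (box `40`, kernel floor sums of part K, in-plane tail). [this file · kind: proof] -/
theorem registryCoupling_three_abs_at_5 : |registryCoupling 3 (50 / 3)| ≤ 0.000000022 := by
  have h0 := boxFloorSum_sound_le (p := 2) (q := 3) (δ := 0) (by norm_num) (by norm_num) (by norm_num)
    5 40 3 (M := 10 ^ 18) (by norm_num)
  have h0' := boxFloorSum_sound_ge (p := 2) (q := 3) (δ := 0) (by norm_num) (by norm_num) (by norm_num)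
    (k := 5) 40 (n := 3) (by norm_num) (Or.inl (by norm_num)) (M := 10 ^ 18) (by norm_num)
  have h1 := boxFloorSum_sound_le (p := 2) (q := 3) (δ := 1) (by norm_num) (by norm_num) (by norm_num)
    5 40 3 (M := 10 ^ 18) (by norm_num)
  have h1' := boxFloorSum_sound_ge (p := 2) (q := 3) (δ := 1) (by norm_num) (by norm_num) (by norm_num)
    (k := 5) 40 (n := 3) (by norm_num) (Or.inl (by norm_num)) (M := 10 ^ 18) (by norm_num)
  rw [boxFloorSum_3_0_5] at h0 h0'
  rw [boxFloorSum_3_1_5] at h1 h1'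
  obtain ⟨ht1, ht2⟩ := abs_le.1 (registryCoupling_three_tail (s := 50 / 3) (by norm_num) (R := 40) le_rfl)
  rw [abs_le]
  norm_num at h0 h0' h1 h1' ht1 ht2 ⊢
  constructor <;> linarith

/-- **`|J⁽3⁾(2·6²/3)| ≤ 0.000000022`**, certified (box `40`, kernel floor sums of part K, in-plane tail). [this file · kind: proof] -/
theorem registryCoupling_three_abs_at_6 : |registryCoupling 3 (24)| ≤ 0.000000022 := by
  have h0 := boxFloorSum_sound_le (p := 2) (q := 3) (δ := 0) (by norm_num) (by norm_num) (by norm_num)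
    6 40 3 (M := 10 ^ 18) (by norm_num)
  have h0' := boxFloorSum_sound_ge (p := 2) (q := 3) (δ := 0) (by norm_num) (by norm_num) (by norm_num)
    (k := 6) 40 (n := 3) (by norm_num) (Or.inl (by norm_num)) (M := 10 ^ 18) (by norm_num)
  have h1 := boxFloorSum_sound_le (p := 2) (q := 3) (δ := 1) (by norm_num) (by norm_num) (by norm_num)
    6 40 3 (M := 10 ^ 18) (by norm_num)
  have h1' := boxFloorSum_sound_ge (p := 2) (q := 3) (δ := 1) (by norm_num) (by norm_num) (by norm_num)
    (k := 6) 40 (n := 3) (by norm_num) (Or.inl (by norm_num)) (M := 10 ^ 18) (by norm_num)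
  rw [boxFloorSum_3_0_6] at h0 h0'
  rw [boxFloorSum_3_1_6] at h1 h1'
  obtain ⟨ht1, ht2⟩ := abs_le.1 (registryCoupling_three_tail (s := 24) (by norm_num) (R := 40) le_rfl)
  rw [abs_le]
  norm_num at h0 h0' h1 h1' ht1 ht2 ⊢
  constructor <;> linarith

/-- **`|J⁽3⁾(2·7²/3)| ≤ 0.000000022`**, certified (box `40`, kernel floor sums of part K, in-plane tail). [this file · kind: proof] -/
theorem registryCoupling_three_abs_at_7 : |registryCoupling 3 (98 / 3)| ≤ 0.000000022 := by
  have h0 := boxFloorSum_sound_le (p := 2) (q := 3) (δ := 0) (by norm_num) (by norm_num) (by norm_num)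
    7 40 3 (M := 10 ^ 18) (by norm_num)
  have h0' := boxFloorSum_sound_ge (p := 2) (q := 3) (δ := 0) (by norm_num) (by norm_num) (by norm_num)
    (k := 7) 40 (n := 3) (by norm_num) (Or.inl (by norm_num)) (M := 10 ^ 18) (by norm_num)
  have h1 := boxFloorSum_sound_le (p := 2) (q := 3) (δ := 1) (by norm_num) (by norm_num) (by norm_num)
    7 40 3 (M := 10 ^ 18) (by norm_num)
  have h1' := boxFloorSum_sound_ge (p := 2) (q := 3) (δ := 1) (by norm_num) (by norm_num) (by norm_num)
    (k := 7) 40 (n := 3) (by norm_num) (Or.inl (by norm_num)) (M := 10 ^ 18) (by norm_num)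
  rw [boxFloorSum_3_0_7] at h0 h0'
  rw [boxFloorSum_3_1_7] at h1 h1'
  obtain ⟨ht1, ht2⟩ := abs_le.1 (registryCoupling_three_tail (s := 98 / 3) (by norm_num) (R := 40) le_rfl)
  rw [abs_le]
  norm_num at h0 h0' h1 h1' ht1 ht2 ⊢
  constructor <;> linarith

/-- **`|J⁽3⁾(2·11²/3)| ≤ 0.000000019`**, certified (box `40`, kernel floor sums of part K, in-plane tail). [this file · kind: proof] -/
theorem registryCoupling_three_abs_at_11 : |registryCoupling 3 (242 / 3)| ≤ 0.000000019 := by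
  have h0 := boxFloorSum_sound_le (p := 2) (q := 3) (δ := 0) (by norm_num) (by norm_num) (by norm_num)
    11 40 3 (M := 10 ^ 18) (by norm_num)
  have h0' := boxFloorSum_sound_ge (p := 2) (q := 3) (δ := 0) (by norm_num) (by norm_num) (by norm_num)
    (k := 11) 40 (n := 3) (by norm_num) (Or.inl (by norm_num)) (M := 10 ^ 18) (by norm_num)
  have h1 := boxFloorSum_sound_le (p := 2) (q := 3) (δ := 1) (by norm_num) (by norm_num) (by norm_num)
    11 40 3 (M := 10 ^ 18) (by norm_num)
  have h1' := boxFloorSum_sound_ge (p := 2) (q := 3) (δ := 1) (by norm_num) (by norm_num) (by norm_num)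
    (k := 11) 40 (n := 3) (by norm_num) (Or.inl (by norm_num)) (M := 10 ^ 18) (by norm_num)
  rw [boxFloorSum_3_0_11] at h0 h0'
  rw [boxFloorSum_3_1_11] at h1 h1'
  obtain ⟨ht1, ht2⟩ := abs_le.1 (registryCoupling_three_tail (s := 242 / 3) (by norm_num) (R := 40) le_rfl)
  rw [abs_le]
  norm_num at h0 h0' h1 h1' ht1 ht2 ⊢
  constructor <;> linarith

/-- **`|J⁽3⁾(2·12²/3)| ≤ 0.000000019`**, certified (box `40`, kernel floor sums of part K, in-plane tail). [this file · kind: proof] -/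
theorem registryCoupling_three_abs_at_12 : |registryCoupling 3 (96)| ≤ 0.000000019 := by
  have h0 := boxFloorSum_sound_le (p := 2) (q := 3) (δ := 0) (by norm_num) (by norm_num) (by norm_num)
    12 40 3 (M := 10 ^ 18) (by norm_num)
  have h0' := boxFloorSum_sound_ge (p := 2) (q := 3) (δ := 0) (by norm_num) (by norm_num) (by norm_num)
    (k := 12) 40 (n := 3) (by norm_num) (Or.inl (by norm_num)) (M := 10 ^ 18) (by norm_num)
  have h1 := boxFloorSum_sound_le (p := 2) (q := 3) (δ := 1) (by norm_num) (by norm_num) (by norm_num)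
    12 40 3 (M := 10 ^ 18) (by norm_num)
  have h1' := boxFloorSum_sound_ge (p := 2) (q := 3) (δ := 1) (by norm_num) (by norm_num) (by norm_num)
    (k := 12) 40 (n := 3) (by norm_num) (Or.inl (by norm_num)) (M := 10 ^ 18) (by norm_num)
  rw [boxFloorSum_3_0_12] at h0 h0'
  rw [boxFloorSum_3_1_12] at h1 h1'
  obtain ⟨ht1, ht2⟩ := abs_le.1 (registryCoupling_three_tail (s := 96) (by norm_num) (R := 40) le_rfl)
  rw [abs_le]
  norm_num at h0 h0' h1 h1' ht1 ht2 ⊢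
  constructor <;> linarith

/-- **`|J⁽3⁾(2·13²/3)| ≤ 0.000000019`**, certified (box `40`, kernel floor sums of part K, in-plane tail). [this file · kind: proof] -/
theorem registryCoupling_three_abs_at_13 : |registryCoupling 3 (338 / 3)| ≤ 0.000000019 := by
  have h0 := boxFloorSum_sound_le (p := 2) (q := 3) (δ := 0) (by norm_num) (by norm_num) (by norm_num)
    13 40 3 (M := 10 ^ 18) (by norm_num)
  have h0' := boxFloorSum_sound_ge (p := 2) (q := 3) (δ := 0) (by norm_num) (by norm_num) (by norm_num)
    (k := 13) 40 (n := 3) (by norm_num) (Or.inl (by norm_num)) (M := 10 ^ 18) (by norm_num)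
  have h1 := boxFloorSum_sound_le (p := 2) (q := 3) (δ := 1) (by norm_num) (by norm_num) (by norm_num)
    13 40 3 (M := 10 ^ 18) (by norm_num)
  have h1' := boxFloorSum_sound_ge (p := 2) (q := 3) (δ := 1) (by norm_num) (by norm_num) (by norm_num)
    (k := 13) 40 (n := 3) (by norm_num) (Or.inl (by norm_num)) (M := 10 ^ 18) (by norm_num)
  rw [boxFloorSum_3_0_13] at h0 h0'
  rw [boxFloorSum_3_1_13] at h1 h1'
  obtain ⟨ht1, ht2⟩ := abs_le.1 (registryCoupling_three_tail (s := 338 / 3) (by norm_num) (R := 40) le_rfl)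
  rw [abs_le]
  norm_num at h0 h0' h1 h1' ht1 ht2 ⊢
  constructor <;> linarith

/-- **`|J⁽3⁾(2·17²/3)| ≤ 0.000000015`**, certified (box `40`, kernel floor sums of part K, in-plane tail). [this file · kind: proof] -/
theorem registryCoupling_three_abs_at_17 : |registryCoupling 3 (578 / 3)| ≤ 0.000000015 := by
  have h0 := boxFloorSum_sound_le (p := 2) (q := 3) (δ := 0) (by norm_num) (by norm_num) (by norm_num)
    17 40 3 (M := 10 ^ 18) (by norm_num)
  have h0' := boxFloorSum_sound_ge (p := 2) (q := 3) (δ := 0) (by norm_num) (by norm_num) (by norm_num)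
    (k := 17) 40 (n := 3) (by norm_num) (Or.inl (by norm_num)) (M := 10 ^ 18) (by norm_num)
  have h1 := boxFloorSum_sound_le (p := 2) (q := 3) (δ := 1) (by norm_num) (by norm_num) (by norm_num)
    17 40 3 (M := 10 ^ 18) (by norm_num)
  have h1' := boxFloorSum_sound_ge (p := 2) (q := 3) (δ := 1) (by norm_num) (by norm_num) (by norm_num)
    (k := 17) 40 (n := 3) (by norm_num) (Or.inl (by norm_num)) (M := 10 ^ 18) (by norm_num)
  rw [boxFloorSum_3_0_17] at h0 h0'
  rw [boxFloorSum_3_1_17] at h1 h1'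
  obtain ⟨ht1, ht2⟩ := abs_le.1 (registryCoupling_three_tail (s := 578 / 3) (by norm_num) (R := 40) le_rfl)
  rw [abs_le]
  norm_num at h0 h0' h1 h1' ht1 ht2 ⊢
  constructor <;> linarith

/-- **`|J⁽3⁾(2·18²/3)| ≤ 0.000000015`**, certified (box `40`, kernel floor sums of part K, in-plane tail). [this file · kind: proof] -/
theorem registryCoupling_three_abs_at_18 : |registryCoupling 3 (216)| ≤ 0.000000015 := by
  have h0 := boxFloorSum_sound_le (p := 2) (q := 3) (δ := 0) (by norm_num) (by norm_num) (by norm_num)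
    18 40 3 (M := 10 ^ 18) (by norm_num)
  have h0' := boxFloorSum_sound_ge (p := 2) (q := 3) (δ := 0) (by norm_num) (by norm_num) (by norm_num)
    (k := 18) 40 (n := 3) (by norm_num) (Or.inl (by norm_num)) (M := 10 ^ 18) (by norm_num)
  have h1 := boxFloorSum_sound_le (p := 2) (q := 3) (δ := 1) (by norm_num) (by norm_num) (by norm_num)
    18 40 3 (M := 10 ^ 18) (by norm_num)
  have h1' := boxFloorSum_sound_ge (p := 2) (q := 3) (δ := 1) (by norm_num) (by norm_num) (by norm_num)
    (k := 18) 40 (n := 3) (by norm_num) (Or.inl (by norm_num)) (M := 10 ^ 18) (by norm_num)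
  rw [boxFloorSum_3_0_18] at h0 h0'
  rw [boxFloorSum_3_1_18] at h1 h1'
  obtain ⟨ht1, ht2⟩ := abs_le.1 (registryCoupling_three_tail (s := 216) (by norm_num) (R := 40) le_rfl)
  rw [abs_le]
  norm_num at h0 h0' h1 h1' ht1 ht2 ⊢
  constructor <;> linarith

/-- **`|J⁽3⁾(2·19²/3)| ≤ 0.000000015`**, certified (box `40`, kernel floor sums of part K, in-plane tail). [this file · kind: proof] -/
theorem registryCoupling_three_abs_at_19 : |registryCoupling 3 (722 / 3)| ≤ 0.000000015 := by
  have h0 := boxFloorSum_sound_le (p := 2) (q := 3) (δ := 0) (by norm_num) (by norm_num) (by norm_num)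
    19 40 3 (M := 10 ^ 18) (by norm_num)
  have h0' := boxFloorSum_sound_ge (p := 2) (q := 3) (δ := 0) (by norm_num) (by norm_num) (by norm_num)
    (k := 19) 40 (n := 3) (by norm_num) (Or.inl (by norm_num)) (M := 10 ^ 18) (by norm_num)
  have h1 := boxFloorSum_sound_le (p := 2) (q := 3) (δ := 1) (by norm_num) (by norm_num) (by norm_num)
    19 40 3 (M := 10 ^ 18) (by norm_num)
  have h1' := boxFloorSum_sound_ge (p := 2) (q := 3) (δ := 1) (by norm_num) (by norm_num) (by norm_num)
    (k := 19) 40 (n := 3) (by norm_num) (Or.inl (by norm_num)) (M := 10 ^ 18) (by norm_num)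
  rw [boxFloorSum_3_0_19] at h0 h0'
  rw [boxFloorSum_3_1_19] at h1 h1'
  obtain ⟨ht1, ht2⟩ := abs_le.1 (registryCoupling_three_tail (s := 722 / 3) (by norm_num) (R := 40) le_rfl)
  rw [abs_le]
  norm_num at h0 h0' h1 h1' ht1 ht2 ⊢
  constructor <;> linarith

/-! ## The crude sixth-power bound and the far-layer majorants -/

/-- **Crude bound of `J⁽⁶⁾`**: `|J⁽⁶⁾(s)| ≤ s⁻⁶ + (24/5) s⁻⁵` for `s > 0` — both layer sums are nonnegative, and each is at most
`s⁻⁶ + (8/(5 α_δ)) s⁻⁵` (`α₀ = 3/4`, `α₁ = 1/3`) by `layerSum_le_of_pos`. [this file · kind: proof] -/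
theorem registryCoupling_six_abs_crude {s : ℝ} (hs : 0 < s) :
    |registryCoupling 6 s| ≤ (s⁻¹) ^ 6 + 24 / 5 * (s⁻¹) ^ 5 := by
  unfold registryCoupling
  have h0 := layerSum_le_of_pos (δ := 0) (by norm_num) hs (d := 5) (by norm_num)
  have h1 := layerSum_le_of_pos (δ := 1) (by norm_num) hs (d := 5) (by norm_num)
  have n0 := layerSum_nonneg (δ := 0) (by norm_num) 6 hs.le
  have n1 := layerSum_nonneg (δ := 1) (by norm_num) 6 hs.le
  rw [abs_le]
  norm_num at h0 h1 ⊢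
  have h5 : 0 ≤ (s ^ 5)⁻¹ := by positivity
  constructor <;> nlinarith [h0, h1, n0, n1, h5]

/-- **Far layers, `n = 3`**: for `k ≥ 22`, `|J⁽³⁾(2k²/3)| ≤ 125·k⁻⁶`
(`(207/20)((81/16)/22² + (32/9)(27/8)) = 124.31 ≤ 125`; `registryCoupling_three_abs` needs `s ≥ 320`, true from `k = 22` on).
[this file · kind: proof] -/
theorem registryCoupling_three_abs_far {k : ℕ} (hk : 22 ≤ k) :
    |registryCoupling 3 ((k : ℝ) ^ 2 * (2 / 3))| ≤ 125 * ((k : ℝ)⁻¹) ^ 6 := by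
  have hk' : (22 : ℝ) ≤ k := by exact_mod_cast hk
  have hkpos : (0 : ℝ) < k := by linarith
  set s : ℝ := (k : ℝ) ^ 2 * (2 / 3) with hs
  have hs320 : 320 ≤ s := by rw [hs]; nlinarith
  refine (registryCoupling_three_abs hs320).trans ?_
  have e3 : (s⁻¹) ^ 3 = 27 / 8 * ((k : ℝ)⁻¹) ^ 6 := by
    rw [hs, mul_inv, mul_pow, ← inv_pow, ← pow_mul]; norm_num; ring
  have hsi : s⁻¹ ≤ 3 / 2 * (1 / 22) ^ 2 := by
    rw [hs, mul_inv]
    have : ((k : ℝ) ^ 2)⁻¹ ≤ (1 / 22) ^ 2 := by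
      rw [← inv_pow, one_div]
      exact pow_le_pow_left₀ (by positivity) (inv_anti₀ (by norm_num) hk') 2
    nlinarith
  have e4 : (s⁻¹) ^ 4 = s⁻¹ * (s⁻¹) ^ 3 := by ring
  have h6 : 0 ≤ ((k : ℝ)⁻¹) ^ 6 := by positivity
  rw [e4, e3]
  nlinarith [mul_le_mul_of_nonneg_right hsi (by positivity : (0:ℝ) ≤ 27 / 8 * ((k : ℝ)⁻¹) ^ 6)]

/-- **Far layers, `n = 6`**: for `k ≥ 22`, `|J⁽⁶⁾(2k²/3)| ≤ k⁻⁶/5000`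
(crude bound: `(729/64) k⁻¹² + (729/20) k⁻¹⁰ ≤ ((729/64)/22⁶ + (729/20)/22⁴)·k⁻⁶ ≤ 1.56·10⁻⁴·k⁻⁶`). [this file · kind: proof] -/
theorem registryCoupling_six_abs_far {k : ℕ} (hk : 22 ≤ k) :
    |registryCoupling 6 ((k : ℝ) ^ 2 * (2 / 3))| ≤ 1 / 5000 * ((k : ℝ)⁻¹) ^ 6 := by
  have hk' : (22 : ℝ) ≤ k := by exact_mod_cast hk
  have hkpos : (0 : ℝ) < k := by linarith
  set s : ℝ := (k : ℝ) ^ 2 * (2 / 3) with hs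
  have hsp : 0 < s := by rw [hs]; positivity
  refine (registryCoupling_six_abs_crude hsp).trans ?_
  have e5 : (s⁻¹) ^ 5 = 243 / 32 * ((k : ℝ)⁻¹) ^ 10 := by
    rw [hs, mul_inv, mul_pow, ← inv_pow, ← pow_mul]; norm_num; ring
  have hsi : s⁻¹ ≤ 3 / 2 * (1 / 22) ^ 2 := by
    rw [hs, mul_inv]
    have : ((k : ℝ) ^ 2)⁻¹ ≤ (1 / 22) ^ 2 := by
      rw [← inv_pow, one_div]
      exact pow_le_pow_left₀ (by positivity) (inv_anti₀ (by norm_num) hk') 2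
    nlinarith
  have hk1 : (k : ℝ)⁻¹ ≤ 1 / 22 := by rw [one_div]; exact inv_anti₀ (by norm_num) hk'
  have hk0 : 0 ≤ (k : ℝ)⁻¹ := by positivity
  have hk4 : ((k : ℝ)⁻¹) ^ 4 ≤ (1 / 22) ^ 4 := pow_le_pow_left₀ hk0 hk1 4
  have h6 : 0 ≤ ((k : ℝ)⁻¹) ^ 6 := by positivity
  have hk10 : ((k : ℝ)⁻¹) ^ 10 ≤ (1 / 22) ^ 4 * ((k : ℝ)⁻¹) ^ 6 := by
    calc ((k : ℝ)⁻¹) ^ 10 = ((k : ℝ)⁻¹) ^ 4 * ((k : ℝ)⁻¹) ^ 6 := by ring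
      _ ≤ (1 / 22) ^ 4 * ((k : ℝ)⁻¹) ^ 6 := mul_le_mul_of_nonneg_right hk4 h6
  have e6 : (s⁻¹) ^ 6 = s⁻¹ * (s⁻¹) ^ 5 := by ring
  rw [e6, e5]
  nlinarith [mul_le_mul_of_nonneg_right hsi (by positivity : (0:ℝ) ≤ 243 / 32 * ((k : ℝ)⁻¹) ^ 10), hk10]

end Summit.AtomisticToContinuum.Crystallization.Theorems.OverbindingBudgetAffineTwinGainEnclosures

end
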